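import Literature.NumberTheory.LFunctions.TaoLogElliottCore
import Literature.NumberTheory.LFunctions.TaoLogElliottProp24
import Literature.NumberTheory.LFunctions.MultiplicativeCorrelationsProofs
import Literature.NumberTheory.LFunctions.TaoLogChowlaLiouvilleAssembly
import Literature.NumberTheory.LFunctions.TaoLogChowlaMoebiusAssembly
import HarnessLib

/-!
# `Literature.NumberTheory.LFunctions.tao_log_chowla_two` and its relatives from Matomäki–Radziwiłł–Tao 2015, Theorem 1.7 alone

With the core of the proof of Tao's Theorem 2.3 now proved
(`Literature.NumberTheory.LFunctions.Tao2016.Tao2016_theorem23_core_holds`, `TaoLogElliottCore.lean`), the named facts of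
`MultiplicativeCorrelations.lean` descending from Tao 2016 are reduced to the single remaining
named input `Literature.NumberTheory.LFunctions.MatomakiRadziwillTao2015_theorem17` (Matomäki–Radziwiłł–Tao, Algebra & Number
Theory 9 (2015), Theorem 1.7 — the exponential sum estimate behind Proposition 2.4):

  `MRT 2015 Thm 1.7 ⟹ Prop 2.4 ⟹ Thm 2.3 ⟹ Thm 1.3 (k = 2) ⟹ Cor 1.5 ⟹ Thm 1.2 (λ, μ; all h)`.

The first three arrows (`Tao2016_theorem23_of_MRT`, `tao_log_averaged_elliott_two_of_MRT`) are
recorded in `TaoLogElliottOfMRT.lean`; this file records the last ones, self-contained on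
`Literature.NumberTheory.LFunctions.tao_log_averaged_elliott_two_of_MRT_core` (`TaoLogElliottProp24.lean`) and
`Literature.NumberTheory.LFunctions.Tao2016.Tao2016_theorem23_core_holds`:

* `tao_log_chowla_two_of_MRT : MatomakiRadziwillTao2015_theorem17 → tao_log_chowla_two`;
* `Parity.tao_log_chowla_liouville_of_MRT`, `Parity.tao_log_chowla_moebius_of_MRT`.

## References
* T. Tao, Forum Math. Pi 4 (2016), e8; arXiv:1509.05422, Theorems 1.2, 1.3, Corollary 1.5,
  §2 (Proposition 2.4, Theorem 2.3).
* K. Matomäki, M. Radziwiłł, T. Tao, Algebra Number Theory 9 (2015), Theorem 1.7.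
-/

namespace Literature.NumberTheory.LFunctions

/-- **Tao 2016, Theorem 1.2 for general shifts** (`Literature.NumberTheory.LFunctions.tao_log_chowla_two`: `λ` and `μ`, all
`h ≠ 0`) from MRT 2015, Theorem 1.7 (via Theorem 1.3 for `k = 2`, itself from Proposition 2.4 and
the proved core of Theorem 2.3). [cite: TaoFMP2016, Theorem 1.2 and Corollary 1.5] -/
theorem tao_log_chowla_two_of_MRT (hMRT : MatomakiRadziwillTao2015_theorem17) : tao_log_chowla_two :=
  tao_log_chowla_two_of_elliott_two
    (tao_log_averaged_elliott_two_of_MRT_core hMRT Tao2016.Tao2016_theorem23_core_holds)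

/-- **parity.S21 (Liouville)** from MRT 2015, Theorem 1.7. [cite: TaoFMP2016, Theorem 1.2] -/
theorem tao_log_chowla_liouville_of_MRT (hMRT : MatomakiRadziwillTao2015_theorem17) :
    Sieve.tao_log_chowla_liouville :=
  LFunctions.tao_log_chowla_liouville_of_MRT_core hMRT Tao2016.Tao2016_theorem23_core_holds

/-- **Tao 2016, (1.2) (Möbius)** from MRT 2015, Theorem 1.7. [cite: TaoFMP2016, Theorem 1.2 ((1.2))] -/
theorem tao_log_chowla_moebius_of_MRT (hMRT : MatomakiRadziwillTao2015_theorem17) :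
    Sieve.tao_log_chowla_moebius :=
  LFunctions.tao_log_chowla_moebius_of_MRT_core hMRT Tao2016.Tao2016_theorem23_core_holds

end Literature.NumberTheory.LFunctions
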